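import Summits.Langlands.Langlands.Theorems.PicardMuOrdinaryMuOrdinaryFamilyRTThorneCompanionAut
import Literature.NumberTheory.GaloisRepresentations.AbsGaloisOuterConj
import HarnessLib

/-!
# Crux `MuOrdinaryFamilyRT` (stmt-Langlands-13757), line `thorne-minimal-lift`: the TWISTING CHARACTER of the pointwise lifting,
# made a datum of the lifting stub (Defs file no. 6 of the line; interface v7 of the lead's stub, blueprint
# `Cruxes/MuOrdinaryFamilyRT/Lines/thorne-minimal-lift-pointAutomorphic.md` §1 step 2)

Thorne 2017 Thm 5.1 (tree fact `Thorne2017.automorphyLifting_unitary_ordinaryMinimal`) is stated for the normalisation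
`ρ^c ≅ ρ^∨ ε^{1-n} = ρ^∨ ε^{-2}`, whereas a point `ρ_y` of the family is polarized with the family's exponent `m = 𝓕.m`
(`TracePolarizedHom F' m`).  The proof of the lifting stub therefore twists `ρ_y|Γ_{F'}` and its companion `r^c` by a continuous
character `θ : Γ_{F'} → ℚ̄₃ˣ` with `θ θ^c = ε^{-2-m}`.  Such a `θ` exists by Clozel–Harris–Taylor 2008 Lemma 4.1.6 (LANDED as the
Literature fact `ClozelHarrisTaylor2008.exists_cm_character_sq_eq_cyclotomic_pow`, p166049: residually TRIVIAL — so the residual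
representation, hence Thorne-adequacy, is unchanged — equal to `ε^{-2-m}` resp. `1` on the inertia groups of a CM type of places above
`3`, unramified almost everywhere, potentially unramified away from `3`).  It depends on `(F', m)` only, NOT on the point `y`; the finitely
many places away from `3` where it ramifies can therefore be absorbed into the level `S'` ONCE for all points (the companion interface
`HasThorneCompanion` is monotone in `S'` thanks to its clause (f) `UnramifiedOff`).  This file makes `θ` a DATUM of the lifting stub:

* `TwistData m F' S' θ` — the five properties of `θ` the proof consumes, at level `S'` (residually trivial; `θ θ^c = ε^{-2-m}` along every
  lift `c̃ ∈ Γ_{F'⁺}` of complex conjugation; on the inertia group at each `w ∣ 3` equal to `ε^{k_w}` with `k_w ∈ {-2-m, 0}`; UNRAMIFIED at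
  every `w ∉ S'` prime to `3`; potentially unramified at the places of `S'` prime to `3`);
* `T.stub_companionsS` — `T.stub_companionsT` (…ThorneCompanionAut) whose auxiliary field ALSO exports `ThreeSplitFromMaximalReal F'` (every
  place above `3` is split over `F'⁺`, which G1 `Missing.auxiliaryCMField` delivers and the CM-type argument of Lemma 4.1.6 needs);
* `T.stub_thorneLiftTw` — pointwise minimal lifting from a Thorne-ready companion AND a twist datum (weaker than `T.stub_thorneLiftT`);
* handle `stub_thorneLiftTw_of_thorneLiftT`.

Reductions (`stub_companionsS_of`, the level-enlarging `definiteHostPlusTw_of`, `MuOrdinaryFamilyRT_of_thorneStubsTw`) are the companion file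
…ThorneTwistReduction.  Nothing is asserted here.
-/

set_option linter.dupNamespace false

namespace Summit.Langlands.Langlands.Cruxes.MuOrdinaryFamilyRT.ThorneMinimalLift

open scoped NumberField Polynomial Matrix Classical
open Field IsDedekindDomain Polynomial
open Literature.NumberTheory.GaloisRepresentations Literature.NumberTheory.Automorphic
open Summit.Langlands.Langlands.Cruxes.MuOrdinaryFamilyRT.CharZeroDominance

noncomputable section

variable {f : ℤ[X]} {ι : PadicAlgCl 3 ≃+* ℂ} {e : K →+* ℂ} {S₀ : Finset (HeightOneSpectrum (𝓞 K))}
  {ρC : FramedGaloisRep K (PadicAlgCl 3) 3}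

/-! ## 1. Twist data -/

/-- **`TwistData m F' S' θ` — the twisting character of the lifting step, at level `S'`.**  `θ : Γ_{F'} → ℚ̄₃ˣ` continuous with:
(t1) `θ` residually trivial (`‖θ(σ) - 1‖ < 1`); (t2) `θ(θ_{c̃} σ) · θ(σ) = ε(σ)^{-2-m}` for every `c̃ ∈ Γ_{F'⁺}` inducing complex conjugation on
the CM field `F'` (`θ θ^c = ε^{-2-m}`, so that the twist of an `ε^m`-polarized representation is `ε^{-2}`-polarized); (t3) at every `w ∣ 3`,
`θ = ε^{k_w}` on the WHOLE inertia group, `k_w ∈ {-2-m, 0}` (crystalline, explicit weight shift); (t4) `θ` unramified at every `w ∉ S'` prime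
to `3`; (t5) `θ` potentially unramified at the places of `S'` prime to `3`.  Intended witness: the character of CHT 2008 Lemma 4.1.6 (tree fact
`ClozelHarrisTaylor2008.exists_cm_character_sq_eq_cyclotomic_pow`) for `ℓ = 3`, `k = -2-m`, a CM type `Φ` of the places above `3`, after
enlarging `S'` by the finitely many places where it ramifies. -/
def TwistData (m : ℤ) (F' : Type) [Field F'] [NumberField F'] [NumberField.IsCMField F']
    (S' : Finset (HeightOneSpectrum (𝓞 F'))) (θ : absoluteGaloisGroup F' →ₜ* (PadicAlgCl 3)ˣ) : Prop :=
  -- (t1) residually trivial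
  (∀ σ : absoluteGaloisGroup F', ‖((θ σ : (PadicAlgCl 3)ˣ) : PadicAlgCl 3) - 1‖ < 1) ∧
  -- (t2) `θ θ^c = ε^{-2-m}`
  (∀ c : absoluteGaloisGroup (NumberField.maximalRealSubfield F'),
    absGaloisQuot (NumberField.maximalRealSubfield F') F' c = NumberField.IsCMField.complexConj F' →
    ∀ σ : absoluteGaloisGroup F',
      ((θ (absGaloisOuterConj (NumberField.maximalRealSubfield F') F' c σ) : (PadicAlgCl 3)ˣ) : PadicAlgCl 3) *
          (θ σ : PadicAlgCl 3) =
        algebraMap ℤ_[3] (PadicAlgCl 3) (((GaloisRep.cyclotomicCharacter F' 3 σ) ^ (-2 - m) : ℤ_[3]ˣ) : ℤ_[3])) ∧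
  -- (t3) at `w ∣ 3`: `θ|_{I_w} = ε^{k_w}|_{I_w}`, `k_w ∈ {-2-m, 0}`
  (∀ w : HeightOneSpectrum (𝓞 F'), ((3 : ℕ) : 𝓞 F') ∈ w.asIdeal →
    ∃ kw : ℤ, (kw = -2 - m ∨ kw = 0) ∧
      ∀ τ ∈ absInertia (w.adicCompletion F'),
        ((θ (absGaloisRestrict F' (w.adicCompletion F') τ) : (PadicAlgCl 3)ˣ) : PadicAlgCl 3) =
          algebraMap ℤ_[3] (PadicAlgCl 3)
            (((GaloisRep.cyclotomicCharacter (w.adicCompletion F') 3 τ) ^ kw : ℤ_[3]ˣ) : ℤ_[3])) ∧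
  -- (t4) unramified outside `S' ∪ {w ∣ 3}`
  (∀ w : HeightOneSpectrum (𝓞 F'), ((3 : ℕ) : 𝓞 F') ∉ w.asIdeal → w ∉ S' →
    ∀ τ ∈ absInertia (w.adicCompletion F'), θ (absGaloisRestrict F' (w.adicCompletion F') τ) = 1) ∧
  -- (t5) potentially unramified on `S' ∖ 3`
  (∀ w ∈ S', ((3 : ℕ) : 𝓞 F') ∉ w.asIdeal →
    ∃ U : OpenSubgroup (absoluteGaloisGroup (w.adicCompletion F')),
      ∀ τ ∈ absInertia (w.adicCompletion F'), τ ∈ U → θ (absGaloisRestrict F' (w.adicCompletion F') τ) = 1)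

/-! ## 2. The v7 stubs -/

/-- **`T.stub_companionsS` — Thorne-ready companions over an auxiliary field with `3` SPLIT from `F'⁺`** (`T.stub_companionsT` of
…ThorneCompanionAut with the extra conclusion `ThreeSplitFromMaximalReal F'`, which G1 `Missing.auxiliaryCMField` delivers for its
field `ℚ(ζ₃, √-p)`; derived in …ThorneTwistReduction from MF1ᵃ + MF2 + G1). -/
def T.stub_companionsS : Prop :=
  ∀ (f : ℤ[X]) (ι : PadicAlgCl 3 ≃+* ℂ) (e : K →+* ℂ) (S₀ : Finset (HeightOneSpectrum (𝓞 K)))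
    (ρC : FramedGaloisRep K (PadicAlgCl 3) 3) (𝓕 : OrdFamily f ι e S₀ ρC),
    Generic f → PicardInput f ι e S₀ ρC → MainClassPlus f S₀ ρC →
    ((4 : ℕ) : WithBot ℕ∞) ≤ ringKrullDim 𝓕.R → PotUnramifiedFamily 𝓕 → Module.Finite 𝓕.Λ 𝓕.R →
    HasWeightData 𝓕 →
    ∃ (F' : Type) (_ : Field F') (_ : NumberField F') (_ : Algebra K F') (_ : IsGalois ℚ F')
      (hcpt' : isCompact_glFiniteIntegralLevel 3 F') (S' : Finset (HeightOneSpectrum (𝓞 F')))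
      (D : Set (𝓕.Λ →+* PadicAlgCl 3)) (E : IntermediateField ℚ_[3] (PadicAlgCl 3)) (_ : NumberField.IsCMField F'),
      Module.finrank K F' = 2 ∧ ThreeSplitFromMaximalReal F' ∧
      ((rbar f 𝓕.B).comp (absGaloisRestrict K F').toMonoidHom).range = (rbar f 𝓕.B).range ∧
      FiniteDimensional ℚ_[3] E ∧
      (∀ w : HeightOneSpectrum (𝓞 F'), w.under (𝓞 K) ∈ S₀ → w ∈ S') ∧
      (∀ κ ∈ D, ∀ a : 𝓕.Λ, κ a ∈ E ∧ ‖κ a‖ ≤ 1) ∧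
      (∀ M : ℕ, ∃ κ ∈ D, ∀ a : 𝓕.Λ,
        ‖κ a - 𝓕.j (𝓕.x (algebraMap 𝓕.Λ 𝓕.R a))‖ ≤ ((3 : ℝ)⁻¹) ^ M) ∧
      ∀ y : 𝓕.R →+* PadicAlgCl 3, y.comp (algebraMap 𝓕.Λ 𝓕.R) ∈ D →
        HasThorneCompanion 𝓕 F' hcpt' S' y

/-- **`T.stub_thorneLiftTw` — POINTWISE MINIMAL AUTOMORPHY LIFTING from a Thorne-ready companion and a TWIST DATUM** (v7; the hypotheses
of `T.stub_thorneLiftT` plus: the auxiliary field is an instance-CM field with `3` split from `F'⁺`, and a character `θ` with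
`TwistData 𝓕.m F' S' θ` is GIVEN).  Intended proof: blueprint — twist `ρ_y|Γ_{F'}` and `r^c` by `θ` (landed glue `tracePolarized_twist`,
`isOrdinaryOfLabelledWeightAt_twist`), pass to the soluble CM extension of CHT Lemma 4.1.2 (tree fact
`ClozelHarrisTaylor2008.exists_solvable_cm_extension_local`) killing the inertial images and the nebentypus (heart image kept:
`range_comp_absGaloisRestrict_eq_of_isField`), crystallinity by Gee–Geraghty Lemma 3.1.4 (3) (tree fact), polarization transport
(`tracePolarizedHom_restrict_outerConj`), Thorne 2017 Thm 5.1 (tree fact), descent (ACC+, tree), untwisting and `ℓ ≠ p` compatibility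
(Caraiani 2012, tree fact p166206) for the output clauses. -/
def T.stub_thorneLiftTw : Prop :=
  ∀ (f : ℤ[X]) (ι : PadicAlgCl 3 ≃+* ℂ) (e : K →+* ℂ) (S₀ : Finset (HeightOneSpectrum (𝓞 K)))
    (ρC : FramedGaloisRep K (PadicAlgCl 3) 3) (𝓕 : OrdFamily f ι e S₀ ρC),
    Generic f → PicardInput f ι e S₀ ρC → MainClassPlus f S₀ ρC → PotUnramifiedFamily 𝓕 →
    ∀ (F' : Type) [Field F'] [NumberField F'] [Algebra K F'] [IsGalois ℚ F'] [NumberField.IsCMField F']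
      (hcpt' : isCompact_glFiniteIntegralLevel 3 F') (S' : Finset (HeightOneSpectrum (𝓞 F'))),
      Module.finrank K F' = 2 → ThreeSplitFromMaximalReal F' →
      ((rbar f 𝓕.B).comp (absGaloisRestrict K F').toMonoidHom).range = (rbar f 𝓕.B).range →
      (∀ w : HeightOneSpectrum (𝓞 F'), w.under (𝓞 K) ∈ S₀ → w ∈ S') →
    ∀ θ : absoluteGaloisGroup F' →ₜ* (PadicAlgCl 3)ˣ, TwistData 𝓕.m F' S' θ →
    ∀ y : 𝓕.R →+* PadicAlgCl 3, HasThorneCompanion 𝓕 F' hcpt' S' y → IsClassicalOver 𝓕 F' hcpt' S' y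

/-! ## 3. Registered handle -/

/-- The v6 lifting stub implies the v7 one (more hypotheses). -/
theorem stub_thorneLiftTw_of_thorneLiftT : T.stub_thorneLiftT → T.stub_thorneLiftTw :=
  fun h f ι e S₀ ρC 𝓕 hgen hin hM hpur F' _ _ _ _ iCM hcpt' S' hdeg _ hrange hS' _ _ y hy =>
    h f ι e S₀ ρC 𝓕 hgen hin hM hpur F' hcpt' S' hdeg iCM hrange hS' y hy

end

end Summit.Langlands.Langlands.Cruxes.MuOrdinaryFamilyRT.ThorneMinimalLift
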